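import Summits.QuantumFields.YangMills.Theorems.FradkinShenkerFlowFiniteSusceptibilityWeakCouplingAutomorphismSector
import Summits.QuantumFields.YangMills.Theorems.FradkinShenkerFlowFiniteSusceptibilityWeakCouplingSpeciesParity
import HarnessLib

/-!
# Crux `FiniteSusceptibilityWeakCoupling` (stmt-QuantumFields-9442), line `purity-rate-split` —
# the purity half cuts losslessly along any involutive global automorphism (charge-conjugation parity)

Companion of `…AutomorphismSector` (invariance of the torus Wilson state under a character-preserving bi-continuous
automorphism `φ` of the gauge group acting link-wise; selection rule `stub_automorphismSelectionRule`; polarisation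
`AutSector.four_mul_autocorr_eq`). Here the cut of the clause of item stmt-QuantumFields-18060 `NoEvenLongRangeOrder`
(purity half of the crux `Summit.QuantumFields.YangMills.Theses.FradkinShenkerFlow.FiniteSusceptibilityWeakCoupling`) is made
self-contained at fixed `(G, r, β, φ)`:

* `AutParity.cfgReflect_aut` — every link-wise automorphism commutes with the site time reflection `Θ = cfgReflect`;
* `AutParity.exists_autSpecies` / `AutParity.exists_autParts` — for a measurable automorphism `φ` and a species `A`,
  `A ∘ φ` is again a species (same support; gauge invariant because `φ` intertwines the gauge transformation by `g` with
  the one by `φ ∘ g`; bounded; measurable), hence so are the parts `P = A + A∘φ`, `M = A − A∘φ`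
  (`SpeciesParity.addSpecies/subSpecies`);
* `AutParity.parts_parity`, `AutParity.parts_timeEven` — for involutive `φ`, `P` is `φ`-even and `M` is `φ`-odd, and both are
  `Θ`-even when `A` is;
* `stub_evenClause_iff_autParity` (registered on stmt-QuantumFields-9442) — **the cut**: for every compact `G`, lattice
  representation `r`, real `β` and involutive bi-continuous automorphism `φ` preserving the Wilson character of `r`, the
  clause of item 18060 at `(G, r, β)` ("every `Θ`-even species decorrelates from itself along the time axis, uniformly in the
  odd tori") holds iff it holds separately for the `Θ`-even `φ`-EVEN species and for the `Θ`-even `φ`-ODD species.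
  With `AutSector.exists_suConj` this is the charge-conjugation cut of the purity half for `SU(N)` with the fundamental Wilson
  action (for `SU(2)` the odd sector is empty, `su2_species_conj_even`; for `SU(N ≥ 3)` it is the sector where a spontaneously
  broken `C` would show, `STRATEGY-CENSUS.md` §S⁺8 / §N9(c)).

No engine: bookkeeping-with-content for the chain of item 18060, `--supports` the crux. Mathlib + tree only.
-/

set_option autoImplicit false

noncomputable section

open MeasureTheory ProbabilityTheory Finset
open Literature.MathematicalPhysics.QuantumFieldTheory hiding Site ZdEdge
open Literature.MathematicalPhysics.QuantumLattice
open Literature.Probability.LatticeModels hiding configShift configShift_apply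

namespace Summit.QuantumFields.YangMills.Theorems.FiniteSusceptibilityWeakCoupling

namespace AutParity

section Algebra

variable {G : Type} [Group G]

/-- **A link-wise automorphism commutes with the site time reflection** `Θ = cfgReflect` (which permutes edges and inverts
the temporal links). [folklore] -/
theorem cfgReflect_aut (φ : G ≃* G) (V : LGConfig 4 G) :
    cfgReflect (fun e => φ (V e)) = fun e => φ (cfgReflect V e) := by
  funext e
  by_cases h : e.2 = 0
  · simp only [cfgReflect, if_pos h, map_inv]
  · simp only [cfgReflect, if_neg h]

/-- A link-wise automorphism intertwines the gauge transformation by `g` with the gauge transformation by `φ ∘ g`. -/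
theorem aut_gaugeTransformZd (φ : G ≃* G) (g : Literature.Probability.LatticeModels.Site 4 → G) (U : LGConfig 4 G) :
    (fun e => φ (gaugeTransformZd g U e)) = gaugeTransformZd (fun x => φ (g x)) (fun e => φ (U e)) := by
  funext e
  simp only [gaugeTransformZd, map_mul, map_inv]

variable [MeasurableSpace G]

/-- **`A ∘ φ` is a species** whenever `A` is and `φ` is a measurable automorphism acting link-wise (stated as an existence,
no definition is introduced): same support, gauge invariant (`aut_gaugeTransformZd`), bounded, measurable. [folklore] -/
theorem exists_autSpecies (φ : G ≃* G) (hφm : Measurable φ) (A : YMSpecies G) :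
    ∃ B : YMSpecies G, ∀ V, B.F V = A.F (fun e => φ (V e)) := by
  refine ⟨{ F := fun V => A.F (fun e => φ (V e))
            supp := A.supp
            isCylinder := ?_
            gaugeInvariant := ?_
            bounded := ?_
            measurable := ?_ }, fun V => rfl⟩
  · intro U V h
    exact A.isCylinder fun e he => by simp only [h e he]
  · intro g U
    show A.F (fun e => φ (gaugeTransformZd g U e)) = A.F (fun e => φ (U e))
    rw [aut_gaugeTransformZd]
    exact A.gaugeInvariant _ _
  · obtain ⟨C, hC⟩ := A.bounded
    exact ⟨C, fun U => hC _⟩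
  · exact A.measurable.comp (measurable_pi_lambda _ fun e => hφm.comp (measurable_pi_apply e))

/-- **The `φ`-parts of a species are species**: there are `P, M : YMSpecies G` with `P = A + A∘φ` and `M = A − A∘φ`
pointwise (`SpeciesParity.addSpecies/subSpecies` of `A` and `A ∘ φ`). [folklore] -/
theorem exists_autParts (φ : G ≃* G) (hφm : Measurable φ) (A : YMSpecies G) :
    ∃ P M : YMSpecies G, (∀ V, P.F V = A.F V + A.F (fun e => φ (V e))) ∧
      (∀ V, M.F V = A.F V - A.F (fun e => φ (V e))) := by
  obtain ⟨B, hB⟩ := exists_autSpecies φ hφm A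
  exact ⟨SpeciesParity.addSpecies A B, SpeciesParity.subSpecies A B,
    fun V => by rw [SpeciesParity.addSpecies_F, hB], fun V => by rw [SpeciesParity.subSpecies_F, hB]⟩

omit [MeasurableSpace G] in
/-- For an involutive `φ`, `P = A + A∘φ` is `φ`-even and `M = A − A∘φ` is `φ`-odd. [folklore] -/
theorem parts_parity [MeasurableSpace G] (φ : G ≃* G) (hφ2 : Function.Involutive φ) {A P M : YMSpecies G}
    (hP : ∀ V, P.F V = A.F V + A.F (fun e => φ (V e))) (hM : ∀ V, M.F V = A.F V - A.F (fun e => φ (V e))) :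
    (∀ V, P.F (fun e => φ (V e)) = P.F V) ∧ (∀ V, M.F (fun e => φ (V e)) = -M.F V) := by
  have hφφ : ∀ V : LGConfig 4 G, (fun e => φ ((fun e' => φ (V e')) e)) = V := fun V => funext fun e => hφ2 (V e)
  exact ⟨fun V => by rw [hP, hP, hφφ]; ring, fun V => by rw [hM, hM, hφφ]; ring⟩

omit [MeasurableSpace G] in
/-- If `A` is `Θ`-even then so are its `φ`-parts (`φ` commutes with `Θ`, `cfgReflect_aut`). [folklore] -/
theorem parts_timeEven [MeasurableSpace G] (φ : G ≃* G) {A P M : YMSpecies G}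
    (hA : ∀ V, A.F (cfgReflect V) = A.F V)
    (hP : ∀ V, P.F V = A.F V + A.F (fun e => φ (V e))) (hM : ∀ V, M.F V = A.F V - A.F (fun e => φ (V e))) :
    (∀ V, P.F (cfgReflect V) = P.F V) ∧ (∀ V, M.F (cfgReflect V) = M.F V) := by
  have key : ∀ V : LGConfig 4 G, A.F (fun e => φ (cfgReflect V e)) = A.F (fun e => φ (V e)) := fun V => by
    rw [← cfgReflect_aut, hA]
  exact ⟨fun V => by rw [hP, hP, hA, key], fun V => by rw [hM, hM, hA, key]⟩

end Algebra

end AutParity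

/-- **Registered stub `stub_evenClause_iff_autParity`** of item stmt-QuantumFields-9442, line `purity-rate-split` (signature
verbatim, fully qualified) — **the purity half cuts losslessly along any involutive character-preserving automorphism**: for
every compact `G`, lattice representation `r`, real `β` and bi-continuous involutive automorphism `φ` of `G` with
`Re tr r.ρ (φ g) = Re tr r.ρ g`, the clause of item 18060 at `(G, r, β)` for all `Θ`-even species is equivalent to the
conjunction of the same clause for the `Θ`-even `φ`-even species and for the `Θ`-even `φ`-odd species. `⇒` is restriction;
`⇐` splits `A` into its `φ`-parts (`AutParity.exists_autParts`, species, `Θ`-even, of pure `φ`-parity) and recombines with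
`AutSector.evenClause_of_parts` (`4·K(A,A) = K(P,P) + K(M,M)`, selection rule). [folklore] -/
theorem stub_evenClause_iff_autParity : ∀ (G : Type) [Group G] [TopologicalSpace G] [IsTopologicalGroup G] [CompactSpace G] [MeasurableSpace G] [BorelSpace G] (r : Literature.MathematicalPhysics.QuantumFieldTheory.LatticeRep G) (β : ℝ) (φ : G ≃* G), Continuous φ → Continuous φ.symm → Function.Involutive φ → (∀ g, ((r.ρ (φ g)).trace).re = ((r.ρ g).trace).re) → ((∀ A : Literature.MathematicalPhysics.QuantumFieldTheory.YMSpecies G, (∀ V, A.F (Literature.MathematicalPhysics.QuantumFieldTheory.cfgReflect V) = A.F V) → ∀ ε : ℝ, 0 < ε → ∃ j₀ : ℕ, ∀ S j : ℕ, j₀ ≤ j → j ≤ S → |Literature.MathematicalPhysics.QuantumFieldTheory.latticeConnectedCorr r.ρ β (2 * S + 1) A.F A.F j| ≤ ε) ↔ ((∀ A : Literature.MathematicalPhysics.QuantumFieldTheory.YMSpecies G, (∀ V, A.F (Literature.MathematicalPhysics.QuantumFieldTheory.cfgReflect V) = A.F V) → (∀ V, A.F (fun e => φ (V e)) = A.F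 V) → ∀ ε : ℝ, 0 < ε → ∃ j₀ : ℕ, ∀ S j : ℕ, j₀ ≤ j → j ≤ S → |Literature.MathematicalPhysics.QuantumFieldTheory.latticeConnectedCorr r.ρ β (2 * S + 1) A.F A.F j| ≤ ε) ∧ (∀ A : Literature.MathematicalPhysics.QuantumFieldTheory.YMSpecies G, (∀ V, A.F (Literature.MathematicalPhysics.QuantumFieldTheory.cfgReflect V) = A.F V) → (∀ V, A.F (fun e => φ (V e)) = -A.F V) → ∀ ε : ℝ, 0 < ε → ∃ j₀ : ℕ, ∀ S j : ℕ, j₀ ≤ j → j ≤ S → |Literature.MathematicalPhysics.QuantumFieldTheory.latticeConnectedCorr r.ρ β (2 * S + 1) A.F A.F j| ≤ ε))) := by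
  intro G _ _ _ _ _ _ r β φ hφ hφs hφ2 hρφ
  refine ⟨fun h => ⟨fun A hA _ => h A hA, fun A hA _ => h A hA⟩, fun h A hA => ?_⟩
  obtain ⟨hE, hO⟩ := h
  obtain ⟨P, M, hP, hM⟩ := AutParity.exists_autParts φ hφ.measurable A
  obtain ⟨hPe, hMo⟩ := AutParity.parts_parity φ hφ2 hP hM
  obtain ⟨hPt, hMt⟩ := AutParity.parts_timeEven φ hA hP hM
  exact AutSector.evenClause_of_parts r β φ hφ hφs hρφ hφ2 A P M hP hM (hE P hPt hPe) (hO M hMt hMo)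

end Summit.QuantumFields.YangMills.Theorems.FiniteSusceptibilityWeakCoupling

end
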